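import Summits.BirchSwinnertonDyer.BirchSwinnertonDyer.Theorems.KolyvaginRoadThreeMethod2Defs
import Summits.BirchSwinnertonDyer.Rank1Residual.X11b.BDPRouteOnTreeStepL
import Summits.BirchSwinnertonDyer.Rank1Residual.X11b.Three.HeegnerDiscriminantBound
import Summits.BirchSwinnertonDyer.Rank1Residual.X11b.Three.StepLAtThree
import Literature.NumberTheory.EllipticCurves.HeegnerPointsClassesProofs
import Literature.NumberTheory.EllipticCurves.HeegnerPointsRationalityProofs
import Literature.NumberTheory.EllipticCurves.BSDSelmerCMPConverseHeegnerFieldProofs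
import Literature.NumberTheory.EllipticCurves.BSDRankZeroDensityProofs
import Literature.NumberTheory.EllipticCurves.IwasawaLeadingTermProofs
import Literature.NumberTheory.EllipticCurves.SelmerCorankHolds
import Mathlib.LinearAlgebra.Dimension.Finrank
import Mathlib.LinearAlgebra.FiniteDimensional.Lemmas
import HarnessLib

/-!
# Route `KolyvaginRoadThree`, deciding crux `ZhangSharpFrameAtThreeHL` (item stmt-BirchSwinnertonDyer-19574):
# the 3-PARITY stub `Method2.stub_oddSelmerRankAtThree` of the METHOD skeleton v2w FROM PUBLISHED INPUTS
# (cell `bsd-stepL`, OWNER seat `bsd-stepL-koly` g12; `--supports stmt-BirchSwinnertonDyer-19574`)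

The registered METHOD skeleton v2w of crux 19574 (koly g12; four stubs) replaced the rank-0-converse conjunct (A6⁰) of
stub A by the small stub P `stub_oddSelmerRankAtThree`: at every Hoffstein–Luo A1 frame `(E, K, Dt, β, ι)`,
`dim_𝔽₃ Sel₃(E/K)` is ODD (the ACCEL seat koly3a's observation p462319: W. Zhang's induction needs the non-vanishing of
the Selmer rank only at the levels it visits, where it is the oddness propagated from the bottom). This file PROVES
stub P's registered signature VERBATIM from four PUBLISHED named facts of the tree:

* `gross_zagier` (Gross–Zagier 1986) and `hasEntireLFunction_rat` (modularity ⇒ entire `L(E, s)`): on an HL frame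
  (`r_an(E) = 1` from `ClassX11b W 3`, `L(E^{d_K}, 1) ≠ 0`) the Heegner point `y_K` is non-torsion — tree theorem
  `X11b.not_isOfFinAddOrder_of_heegner_of_analyticRank_eq_one`;
* `kolyvagin` (Kolyvagin 1990: `y_K` non-torsion ⇒ `rank E(K) = 1` and `Ш(E/K)` finite);
* `WeierstrassCurve.exists_casselsTate_pairing` (Cassels 1962 ∕ Tate 1963: the alternating pairing on `Ш(E/K)`) —
  through the tree theorem `exists_selmerRank_eq_add`: `#Sel₃(E/K) = 3^s`, `#E(K)[3] = 3^t` ⇒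
  `s = t + corank_3 + 2m`;
and the tree theorems `selmerCorank_eq_mordellWeilRank_add_holds` (`corank = rank + corank Ш`),
`finite_primaryComponent_sha_iff_shaCorank_eq_zero`, `torsionBy_eq_bot_of_isImaginaryQuadratic_of_hasIrreducibleModPGaloisRep`
(`E(K)[3] = 0` from `Irr W 3`). So `s = 0 + 1 + 2m` is odd.

THEOREMS: `odd_selmerRank_of_rankOne_of_finiteSha` (any number field: rank one + `Ш` finite + no 3-torsion +
Cassels–Tate ⇒ `#Sel₃ = 3^s` with `s` odd), `finrank_selmer_eq_of_natCard_eq_pow` (the `Nat.card ↔ finrank`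
dictionary), and `stub_oddSelmerRankAtThree_of_published` — THE REGISTERED STUB SIGNATURE as conclusion, from the four
facts. CONDITIONAL on the named facts (all PUB); 0 defs, 0 `sorry`. PARTITION: O2@3 (B10) × A1 × crux 19574 — none
(a stub of the method skeleton modulo published inputs; closes nothing by itself; T7).

References: [cite: GrossZagier1986Heegner, Thm. I.6.3] [cite: KolyvaginEulerSystems1990, Thm. A]
[cite: SilvermanAEC2009, Thm. X.4.14 (Cassels–Tate)] [cite: GrossLMS1991, §10 (Prop. 2.3)] [cite: WZhang2014, Thm. 9.2].
-/

noncomputable section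

open scoped Classical

namespace Summit.BirchSwinnertonDyer.Rank1Residual.X11b.Three.Koly.Method2

open WeierstrassCurve NumberField IsDedekindDomain Literature.NumberTheory.EllipticCurves
  Literature.NumberTheory.EllipticCurves.ModularForms
  Literature.NumberTheory.EllipticCurves.Rank1Residual
  Summit.BirchSwinnertonDyer.Rank1Residual Summit.BirchSwinnertonDyer.Rank1Residual.X11b Module

/-! ## Rank one + `Ш` finite + no `3`-torsion ⇒ odd `3`-Selmer rank (any number field) -/

/-- **Odd `3`-Selmer rank from rank one.** For an elliptic curve `E` over a number field with `rank E(K) = 1`,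
`Ш(E/K)` finite and `E(K)[3] = 0`, granting the Cassels–Tate pairing, `#Sel₃(E/K) = 3^s` with `s` ODD:
`s = t + corank₃ + 2m` (tree `exists_selmerRank_eq_add`) with `t = 0`, `corank₃ = rank + corank Ш[3^∞] = 1 + 0`.
[cite: SilvermanAEC2009, Thm. X.4.14] -/
theorem odd_selmerRank_of_rankOne_of_finiteSha {F : Type} [Field F] [NumberField F] (E : WeierstrassCurve F)
    [E.IsElliptic] (hCT : exists_casselsTate_pairing (K := F)) (hrank : E.mordellWeilRank = 1)
    (hSha : Finite E.sha) (htors : AddSubgroup.torsionBy E.toAffine.Point ((3 : ℕ) : ℤ) = ⊥) :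
    ∃ s : ℕ, Odd s ∧ Nat.card (E.selmerGroup ((3 : ℕ) : ℤ)) = 3 ^ s := by
  haveI : Fact (Nat.Prime 3) := ⟨Nat.prime_three⟩
  obtain ⟨s, hs⟩ := exists_natCard_selmerGroup_eq_pow E 3
  have ht : Nat.card (AddSubgroup.torsionBy E.toAffine.Point ((3 : ℕ) : ℤ)) = 3 ^ 0 := by
    rw [htors, pow_zero, AddSubgroup.card_bot]
  obtain ⟨m, hm⟩ := exists_selmerRank_eq_add hCT E 3 s 0 hs ht
  have hsha0 : E.shaCorank 3 = 0 := by
    rw [← finite_primaryComponent_sha_iff_shaCorank_eq_zero E 3]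
    haveI := hSha
    infer_instance
  have hcorank : E.selmerCorank 3 = 1 := by
    rw [E.selmerCorank_eq_mordellWeilRank_add_holds 3, hrank, hsha0]
  refine ⟨s, ⟨m, ?_⟩, hs⟩
  rw [hm, hcorank]
  ring

/-- **`Nat.card ↔ finrank` for `Sel₃(E/K)` as a `ZMod 3`-space**: `#Sel₃ = 3^s` gives `dim_𝔽₃ Sel₃ = s`.
[folklore] -/
theorem finrank_selmer_eq_of_natCard_eq_pow {F : Type} [Field F] [NumberField F] (E : WeierstrassCurve F)
    [E.IsElliptic] [Module (ZMod 3) (galH1Torsion E ((3 ^ 1 : ℕ) : ℤ))] {s : ℕ}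
    (hs : Nat.card (E.selmerGroup ((3 ^ 1 : ℕ) : ℤ)) = 3 ^ s) :
    finrank (ZMod 3) (AddSubgroup.toZModSubmodule 3 (E.selmerGroup ((3 ^ 1 : ℕ) : ℤ))) = s := by
  haveI : Fact (Nat.Prime 3) := ⟨Nat.prime_three⟩
  have hN3 : (((3 ^ 1 : ℕ) : ℤ)) ≠ 0 := by norm_num
  haveI : Finite (E.selmerGroup ((3 ^ 1 : ℕ) : ℤ)) := E.finite_selmerGroup_holds hN3
  haveI : Finite (AddSubgroup.toZModSubmodule 3 (E.selmerGroup ((3 ^ 1 : ℕ) : ℤ))) :=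
    Finite.of_equiv _ (Equiv.setCongr (AddSubgroup.coe_toZModSubmodule 3 _).symm)
  have h : 3 ^ finrank (ZMod 3) (AddSubgroup.toZModSubmodule 3 (E.selmerGroup ((3 ^ 1 : ℕ) : ℤ))) = 3 ^ s := by
    rw [pow_finrank_eq_natCard, ← hs]
    exact Nat.card_congr (Equiv.setCongr (AddSubgroup.coe_toZModSubmodule 3 _))
  exact Nat.pow_right_injective (by norm_num : 2 ≤ 3) h

/-! ## The stub from published inputs -/

/-- **`Method2.stub_oddSelmerRankAtThree` (v2w) FROM PUBLISHED INPUTS — the registered signature VERBATIM.** At every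
Hoffstein–Luo A1 frame `dim_𝔽₃ Sel₃(E/K)` is odd: the Heegner point `y_K` is non-torsion (Gross–Zagier on the HL frame:
`r_an(E) = 1`, `L(E^{d_K}, 1) ≠ 0`; modularity for the factorisation `L(E/K, s) = L(E, s) L(E^{d_K}, s)`), so
`rank E(K) = 1` and `Ш(E/K)` is finite (Kolyvagin), `E(K)[3] = 0` (`Irr W 3` over the quadratic field `K`), and
Cassels–Tate makes `dim_𝔽₃ Ш(E/K)[3]` even. CONDITIONAL on the four named facts (all published).
[cite: GrossZagier1986Heegner, Thm. I.6.3] [cite: KolyvaginEulerSystems1990, Thm. A] [cite: SilvermanAEC2009,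
Thm. X.4.14] -/
theorem stub_oddSelmerRankAtThree_of_published
    (hGZ : ∀ (N : ℕ) [NeZero N] (W : WeierstrassCurve ℚ) (K : Type) [Field K] [NumberField K], gross_zagier N W K)
    (hKo : ∀ (N : ℕ) [NeZero N] (W : WeierstrassCurve ℚ) (K : Type) [Field K] [NumberField K], kolyvagin N W K)
    (hmod : hasEntireLFunction_rat)
    (hCT : ∀ (F : Type) [Field F] [NumberField F], exists_casselsTate_pairing (K := F)) :
    ∀ (W : WeierstrassCurve ℚ) [W.IsElliptic] [W.IsGloballyMinimal] [NeZero (W.conductorNorm ℤ)] (K : Type)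
      [Field K] [NumberField K] (Dt : ModularParametrizationData W (W.conductorNorm ℤ)) (β : ℤ) (ι : K →+* ℂ),
      Summit.BirchSwinnertonDyer.Rank1Residual.ClassX11b W 3 → W.HasMultiplicativeReductionAtPrime 3 →
      Rank1Residual.Surj W 3 → Rank1Residual.Ram W 3 → ¬ 3 ∣ W.tamagawaProduct → IsImaginaryQuadratic K →
      Odd (NumberField.discr K) → SatisfiesHeegnerHypothesis (W.conductorNorm ℤ) K →
      (W.quadraticTwist (NumberField.discr K : ℚ)).entireLFunction 1 ≠ 0 → NumberField.discr K ≠ -3 →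
      (4 * (W.conductorNorm ℤ : ℤ)) ∣ β ^ 2 - NumberField.discr K → ¬ (3 : ℤ) ∣ Dt.c →
      ∀ [Module (ZMod 3) (V3 W K)],
      Odd (finrank (ZMod 3)
        (AddSubgroup.toZModSubmodule 3 (selmerGroup (W.baseChange K) ((3 ^ 1 : ℕ) : ℤ)))) := by
  intro W _ _ _ K _ _ Dt β ι hX _hmult _hsurj _hram _htam hK _hodd hH hLt _h3 hβ _hc _
  haveI : Fact (Nat.Prime 3) := ⟨Nat.prime_three⟩
  have hirr : Irr W 3 := hX.2.2.2
  -- `d_K < 0`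
  have hDneg : NumberField.discr K < 0 := by
    have hND : IsCoprime (W.conductorNorm ℤ : ℤ) (NumberField.discr K) := by
      have h := Literature.SatisfiesHeegnerHypothesis.coprime_discr hK.1 hH
      refine Int.isCoprime_iff_gcd_eq_one.mpr ?_
      rw [Int.gcd_eq_natAbs, Int.natAbs_natCast]
      exact h
    have hlt := Three.discr_lt_neg_four_of_isCoprime_of_dvd_sq_sub hK hND (Three.dvd_conductorNorm_of_classX11b hX) hβ
    omega
  -- THE Heegner point `P = y_K ∈ E(K)` of the frame, non-torsion by Gross–Zagier
  obtain ⟨H, -⟩ := exists_heegnerDatum (W.conductorNorm ℤ) hDneg hβ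
  obtain ⟨P, hP⟩ := heegnerPointComplex_mem_range_map_holds (W.conductorNorm ℤ) W K hK hH Dt H ι
  have hPinf : ¬ IsOfFinAddOrder P :=
    not_isOfFinAddOrder_of_heegner_of_analyticRank_eq_one W (W.conductorNorm ℤ) K Dt H ι P (hGZ _ W K) hmod hX.1 hK
      hH hLt hP
  -- Kolyvagin: rank one and `Ш(E/K)` finite; no `3`-torsion over `K`
  obtain ⟨hrank, hSha⟩ := hKo _ W K hK hH ⟨Dt, H, ι, hP⟩ hPinf
  have hbot := torsionBy_eq_bot_of_isImaginaryQuadratic_of_hasIrreducibleModPGaloisRep W K hK Nat.prime_three hirr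
  obtain ⟨s, hsodd, hs⟩ := odd_selmerRank_of_rankOne_of_finiteSha (W.baseChange K) (hCT K) hrank hSha hbot
  rw [finrank_selmer_eq_of_natCard_eq_pow (W.baseChange K) hs]
  exact hsodd

end Summit.BirchSwinnertonDyer.Rank1Residual.X11b.Three.Koly.Method2

end
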